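import Literature.NumberTheory.LFunctions.SuzukiSingleOperatorKernel

/-!
# SuzukiWindowsDoorDirichletSymbol — the prime part `exp(−2θ ζ'/ζ(s)) = Σ λ_θ(n) n^{-s}` of Suzuki's single-operator symbol (column DBR; RH-FREE)

RH-FREE throughout; nothing here bears on the truth of RH.  Second of three files proving the column's
PROOF-OF-DATA target `LimKernelWindowIdentity` ([Su20] (1.12)).  Here: the Dirichlet series identity [Su20] (1.10)
(M. Suzuki, ASPM 84 (2020) = arXiv:1907.07302, §1), for the tree's Ihara–Matsumoto coefficients
`limCoeff θ n = λ_θ(n) = Σ_{j ≤ Ω(n)} (2θ)ʲ/j! · Λ^{∗j}(n)` (`Literature.NumberTheory.LFunctions.limCoeff`):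

* §1 the convolution powers `Λ^{∗j}`: `Λ^{∗j} ≥ 0` and `Λ^{∗j}(n) = 0` for `j > Ω(n)` (so `λ_θ(n)` is the FULL
  exponential series `Σ_j (2θ)ʲ/j! Λ^{∗j}(n)`), `λ_θ ≥ 0` for `θ ≥ 0`;
* §2 `Σ_n Λ^{∗j}(n) n^{-s} = (Σ_n Λ(n) n^{-s})ʲ` for `Re s > 1` (Mathlib's `LSeriesHasSum.convolution`), and the
  absolute version `Σ_n Λ^{∗j}(n) n^{-σ} = (Σ_n Λ(n) n^{-σ})ʲ`;
* §3 absolute summability of the double family `(2θ)ʲ/j! · Λ^{∗j}(n) n^{-s}` (its norms sum to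
  `exp(2|θ| Σ Λ(n) n^{-Re s})`), and, summing it by rows and by columns (`HasSum.prod_fiberwise`),
  **`LSeriesHasSum ↗λ_θ s (exp(2θ Σ Λ(n) n^{-s}))`**, i.e. `Σ λ_θ(n) n^{-s} = exp(−2θ ζ'/ζ(s))` on `Re s > 1`
  (`Σ Λ(n) n^{-s} = −ζ'/ζ(s)`, Mathlib `ArithmeticFunction.LSeries_vonMangoldt_eq_deriv_riemannZeta_div`), with the
  absolute convergence `Σ |λ_θ(n)| n^{-Re s} < ∞` that the window identity needs for the termwise inverse Fourier
  transform.

References: [Su20] M. Suzuki, ASPM 84 (2020) 399–411 = arXiv:1907.07302, §1 (1.10) («endowed with multiplicative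
coefficients `λ_θ(n)`», Ihara–Matsumoto).
-/

noncomputable section

-- D-0017: `Summit.<S>.<S>.…` is the designed namespace of a single-problem summit.
set_option linter.dupNamespace false

open Filter Topology Complex

namespace Summit.RiemannHypothesis.RiemannHypothesis.Theorems.SuzukiWindowsDoorDirichletSymbol

open Literature.NumberTheory.LFunctions
open LSeries
open scoped LSeries.notation ArithmeticFunction.vonMangoldt ArithmeticFunction.Omega Nat
open ArithmeticFunction (mul_apply one_apply cardFactors_mul cardFactors_apply_prime_pow vonMangoldt_nonneg
  vonMangoldt_ne_zero_iff LSeriesSummable_vonMangoldt)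

/-! ## §1 The convolution powers `Λ^{∗j}` and the coefficients `λ_θ` -/

/-- RH-FREE.  `Λ^{∗j}(n) ≥ 0` (a sum of products of values of `Λ ≥ 0`). -/
theorem vonMangoldt_pow_nonneg (j n : ℕ) : 0 ≤ (Λ ^ j) n := by
  induction j generalizing n with
  | zero =>
    rw [pow_zero, one_apply]
    split_ifs <;> norm_num
  | succ j ih =>
    rw [pow_succ, mul_apply]
    exact Finset.sum_nonneg fun p _ => mul_nonneg (ih _) vonMangoldt_nonneg

/-- RH-FREE.  `Λ^{∗j}(n) = 0` for `j > Ω(n)`: in `Λ^{∗(j+1)}(n) = Σ_{ab = n} Λ^{∗j}(a) Λ(b)` a non-zero `Λ(b)` forces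
`b = p^k`, `k ≥ 1`, so `Ω(a) = Ω(n) − k < j`. -/
theorem vonMangoldt_pow_apply_eq_zero {j n : ℕ} (h : Ω n < j) : (Λ ^ j) n = 0 := by
  induction j generalizing n with
  | zero => exact absurd h (Nat.not_lt_zero _)
  | succ j ih =>
    rw [pow_succ, mul_apply]
    refine Finset.sum_eq_zero fun p hp => ?_
    obtain ⟨hpn, hn0⟩ := Nat.mem_divisorsAntidiagonal.1 hp
    by_cases hΛ : Λ p.2 = 0
    · rw [hΛ, mul_zero]
    · obtain ⟨q, k, hq, _, hqk⟩ := (isPrimePow_nat_iff _).1 (vonMangoldt_ne_zero_iff.1 hΛ)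
      have h12 : p.1 * p.2 ≠ 0 := by rw [hpn]; exact hn0
      have h1 : p.1 ≠ 0 := left_ne_zero_of_mul h12
      have h2 : p.2 ≠ 0 := right_ne_zero_of_mul h12
      have hΩ : Ω n = Ω p.1 + Ω p.2 := by rw [← hpn, cardFactors_mul h1 h2]
      have hΩ2 : Ω p.2 = k := by rw [← hqk, cardFactors_apply_prime_pow hq]
      rw [ih (by omega), zero_mul]

/-- RH-FREE.  `λ_θ(n)` is the FULL exponential series `Σ_j (2θ)ʲ/j! · Λ^{∗j}(n)` (the terms `j > Ω(n)` vanish).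
[Su20] (1.10). -/
theorem hasSum_limCoeff (θ : ℝ) (n : ℕ) :
    HasSum (fun j : ℕ => (2 * θ) ^ j / (j.factorial : ℝ) * (Λ ^ j) n) (limCoeff θ n) := by
  unfold limCoeff
  apply hasSum_sum_of_ne_finset_zero
  intro j hj
  rw [Finset.mem_range, not_lt] at hj
  rw [vonMangoldt_pow_apply_eq_zero (by omega), mul_zero]

/-- RH-FREE.  `λ_θ(n) ≥ 0` for `θ ≥ 0`. -/
theorem limCoeff_nonneg {θ : ℝ} (hθ : 0 ≤ θ) (n : ℕ) : 0 ≤ limCoeff θ n :=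
  Finset.sum_nonneg fun j _ =>
    mul_nonneg (div_nonneg (pow_nonneg (by linarith) _) (Nat.cast_nonneg _)) (vonMangoldt_pow_nonneg j n)

/-! ## §2 `Σ_n Λ^{∗j}(n) n^{-s} = (Σ_n Λ(n) n^{-s})ʲ` on `Re s > 1` -/

/-- `↗(Λ^{∗(j+1)}) = ↗(Λ^{∗j}) ⍟ ↗Λ` (casting a real Dirichlet product to `ℂ`). -/
theorem coe_vonMangoldt_pow_succ (j : ℕ) : ↗(Λ ^ (j + 1)) = ↗(Λ ^ j) ⍟ ↗Λ := by
  funext n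
  rw [convolution_def, pow_succ, mul_apply]
  push_cast
  rfl

/-- `↗(Λ^{∗0}) = δ`. -/
theorem coe_vonMangoldt_pow_zero : ↗(Λ ^ 0) = δ := by
  funext n
  rw [pow_zero, one_apply]
  simp [LSeries.delta, apply_ite]

/-- RH-FREE.  For `Re s > 1` and every `j`: `Σ_n Λ^{∗j}(n) n^{-s}` converges (absolutely) with sum
`(Σ_n Λ(n) n^{-s})ʲ`. -/
theorem LSeriesHasSum_vonMangoldt_pow {s : ℂ} (hs : 1 < s.re) (j : ℕ) :
    LSeriesHasSum ↗(Λ ^ j) s ((L ↗Λ s) ^ j) := by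
  induction j with
  | zero =>
    rw [coe_vonMangoldt_pow_zero, pow_zero]
    show HasSum (term δ s) 1
    rw [show term δ s = fun n : ℕ => if n = 1 then (1 : ℂ) else 0 from funext (term_delta s)]
    exact hasSum_ite_eq 1 1
  | succ j ih =>
    rw [coe_vonMangoldt_pow_succ, pow_succ]
    exact ih.convolution (LSeriesSummable_vonMangoldt hs).LSeriesHasSum

/-- `‖f(n) n^{-s}‖` depends on `s` only through `Re s`. -/
theorem norm_term_eq_norm_term_re (f : ℕ → ℂ) (s : ℂ) (n : ℕ) :
    ‖term f s n‖ = ‖term f (s.re : ℂ) n‖ := by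
  simp only [norm_term_eq, Complex.ofReal_re]

/-- For `F ≥ 0` and real `σ`, the term `F(n) n^{-σ}` IS the non-negative real `‖F(n) n^{-σ}‖`. -/
theorem term_eq_ofReal_norm {F : ℕ → ℝ} (hF : ∀ n, 0 ≤ F n) (σ : ℝ) (n : ℕ) :
    term (fun n => (F n : ℂ)) (σ : ℂ) n = ((‖term (fun n => (F n : ℂ)) (σ : ℂ) n‖ : ℝ) : ℂ) := by
  rcases eq_or_ne n 0 with rfl | hn
  · simp only [term_zero, norm_zero, Complex.ofReal_zero]
  · rw [norm_term_eq, if_neg hn, term_of_ne_zero hn, Complex.ofReal_re, Complex.norm_real,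
      Real.norm_of_nonneg (hF n), Complex.ofReal_div, Complex.ofReal_cpow (Nat.cast_nonneg n),
      Complex.ofReal_natCast]

/-- For `F ≥ 0` and real `σ` with `Σ F(n) n^{-σ}` summable: `Σ F(n) n^{-σ} = ↑(Σ ‖F(n) n^{-σ}‖)`. -/
theorem LSeries_eq_ofReal_tsum_norm {F : ℕ → ℝ} (hF : ∀ n, 0 ≤ F n) (σ : ℝ) :
    L (fun n => (F n : ℂ)) (σ : ℂ) = ((∑' n : ℕ, ‖term (fun n => (F n : ℂ)) (σ : ℂ) n‖ : ℝ) : ℂ) := by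
  rw [Complex.ofReal_tsum]
  exact tsum_congr fun n => term_eq_ofReal_norm hF σ n

/-- RH-FREE.  **Absolute version**: for `Re s > 1`, `Σ_n ‖Λ^{∗j}(n) n^{-s}‖ = (Σ_n ‖Λ(n) n^{-Re s}‖)ʲ`. -/
theorem tsum_norm_term_vonMangoldt_pow {s : ℂ} (hs : 1 < s.re) (j : ℕ) :
    ∑' n : ℕ, ‖term ↗(Λ ^ j) s n‖ = (∑' n : ℕ, ‖term ↗Λ (s.re : ℂ) n‖) ^ j := by
  set σ : ℝ := s.re with hσ
  have hσ1 : 1 < (σ : ℂ).re := by simpa [hσ] using hs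
  have h1 : ∑' n : ℕ, ‖term ↗(Λ ^ j) s n‖ = ∑' n : ℕ, ‖term ↗(Λ ^ j) (σ : ℂ) n‖ :=
    tsum_congr fun n => norm_term_eq_norm_term_re _ s n
  rw [h1]
  have hj := (LSeriesHasSum_vonMangoldt_pow hσ1 j).LSeries_eq
  have hA : L ↗(Λ ^ j) (σ : ℂ) = ((∑' n : ℕ, ‖term ↗(Λ ^ j) (σ : ℂ) n‖ : ℝ) : ℂ) :=
    LSeries_eq_ofReal_tsum_norm (vonMangoldt_pow_nonneg j) σ
  have hB : L ↗Λ (σ : ℂ) = ((∑' n : ℕ, ‖term ↗Λ (σ : ℂ) n‖ : ℝ) : ℂ) :=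
    LSeries_eq_ofReal_tsum_norm (fun _ => vonMangoldt_nonneg) σ
  rw [hA, hB, ← Complex.ofReal_pow] at hj
  exact_mod_cast hj

/-! ## §3 The double family `(2θ)ʲ/j! · Λ^{∗j}(n) n^{-s}` and `Σ λ_θ(n) n^{-s} = exp(2θ Σ Λ(n) n^{-s})` -/

/-- The double family is `a_{θ,s}(j, n) = (2θ)ʲ/j! · Λ^{∗j}(n) n^{-s}` (written out in every statement below);
termwise `‖a(j,n)‖ = (2|θ|)ʲ/j! · ‖Λ^{∗j}(n) n^{-s}‖`. -/
theorem norm_expFamily (θ : ℝ) (s : ℂ) (j n : ℕ) :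
    ‖(((2 * θ) ^ j / (j.factorial : ℝ) : ℝ) : ℂ) * term ↗(Λ ^ j) s n‖ =
      (2 * |θ|) ^ j / (j.factorial : ℝ) * ‖term ↗(Λ ^ j) s n‖ := by
  rw [norm_mul, Complex.norm_real, Real.norm_eq_abs, abs_div, abs_pow, abs_mul, abs_two, Nat.abs_cast]

/-- RH-FREE.  **Absolute summability of the double family** on `Re s > 1`: its norms are summable over `ℕ × ℕ`
(rows sum to `(2|θ|)ʲ/j! · Zʲ`, `Z = Σ Λ(n) n^{-Re s}`, and `Σ_j (2|θ|Z)ʲ/j! = e^{2|θ|Z}`). -/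
theorem summable_norm_expFamily (θ : ℝ) {s : ℂ} (hs : 1 < s.re) :
    Summable fun p : ℕ × ℕ => ‖(((2 * θ) ^ p.1 / (p.1.factorial : ℝ) : ℝ) : ℂ) * term ↗(Λ ^ p.1) s p.2‖ := by
  set Z : ℝ := ∑' n : ℕ, ‖term ↗Λ (s.re : ℂ) n‖ with hZ
  refine (summable_prod_of_nonneg fun p => norm_nonneg _).2 ⟨fun j => ?_, ?_⟩
  · simp_rw [norm_expFamily]
    exact (Summable.norm ((LSeriesHasSum_vonMangoldt_pow hs j).LSeriesSummable :
      Summable (term ↗(Λ ^ j) s))).mul_left _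
  · simp_rw [norm_expFamily]
    have h : ∀ j : ℕ, ∑' n : ℕ, (2 * |θ|) ^ j / (j.factorial : ℝ) * ‖term ↗(Λ ^ j) s n‖ =
        (2 * |θ| * Z) ^ j / (j.factorial : ℝ) := by
      intro j
      rw [tsum_mul_left, tsum_norm_term_vonMangoldt_pow hs j, ← hZ, mul_pow]
      ring
    simp_rw [h]
    exact Real.summable_pow_div_factorial _

/-- RH-FREE.  The double family is summable over `ℕ × ℕ` on `Re s > 1`. -/
theorem summable_expFamily (θ : ℝ) {s : ℂ} (hs : 1 < s.re) :
    Summable fun p : ℕ × ℕ => (((2 * θ) ^ p.1 / (p.1.factorial : ℝ) : ℝ) : ℂ) * term ↗(Λ ^ p.1) s p.2 :=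
  (summable_norm_expFamily θ hs).of_norm

/-- Rows: `Σ_n a(j, n) = (2θ)ʲ/j! · (Σ Λ(n) n^{-s})ʲ`. -/
theorem hasSum_expFamily_row (θ : ℝ) {s : ℂ} (hs : 1 < s.re) (j : ℕ) :
    HasSum (fun n : ℕ => (((2 * θ) ^ j / (j.factorial : ℝ) : ℝ) : ℂ) * term ↗(Λ ^ j) s n)
      ((((2 * θ) ^ j / (j.factorial : ℝ) : ℝ) : ℂ) * (L ↗Λ s) ^ j) :=
  (LSeriesHasSum_vonMangoldt_pow hs j).mul_left _

/-- Columns: `Σ_j a(j, n) = λ_θ(n) n^{-s}`. -/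
theorem hasSum_expFamily_col (θ : ℝ) (s : ℂ) (n : ℕ) :
    HasSum (fun j : ℕ => (((2 * θ) ^ j / (j.factorial : ℝ) : ℝ) : ℂ) * term ↗(Λ ^ j) s n)
      (term (fun n => (limCoeff θ n : ℂ)) s n) := by
  rcases eq_or_ne n 0 with rfl | hn
  · simp only [term_zero, mul_zero]
    exact hasSum_zero
  · have h := (Complex.hasSum_ofReal.2 (hasSum_limCoeff θ n)).div_const ((n : ℂ) ^ s)
    rw [term_of_ne_zero hn]
    have hfun : (fun j : ℕ => (((2 * θ) ^ j / (j.factorial : ℝ) : ℝ) : ℂ) * term ↗(Λ ^ j) s n) =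
        fun j : ℕ => (((2 * θ) ^ j / (j.factorial : ℝ) * (Λ ^ j) n : ℝ) : ℂ) / (n : ℂ) ^ s := by
      funext j
      simp only [term_of_ne_zero hn]
      push_cast
      ring
    rw [hfun]
    exact h

/-- The exponential series: `Σ_j (2θ)ʲ/j! · wʲ = exp(2θ w)`. -/
theorem hasSum_exp_series (θ : ℝ) (w : ℂ) :
    HasSum (fun j : ℕ => (((2 * θ) ^ j / (j.factorial : ℝ) : ℝ) : ℂ) * w ^ j) (Complex.exp (2 * θ * w)) := by
  have h := NormedSpace.expSeries_div_hasSum_exp (2 * (θ : ℂ) * w)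
  rw [← congr_fun Complex.exp_eq_exp_ℂ (2 * (θ : ℂ) * w)] at h
  have hfun : (fun j : ℕ => (((2 * θ) ^ j / (j.factorial : ℝ) : ℝ) : ℂ) * w ^ j) =
      fun j : ℕ => (2 * (θ : ℂ) * w) ^ j / (j.factorial : ℂ) := by
    funext j
    push_cast
    ring
  rw [hfun]
  exact h

/-- RH-FREE.  **[Su20] (1.10) PROVED: `Σ λ_θ(n) n^{-s} = exp(2θ Σ Λ(n) n^{-s}) = exp(−2θ ζ'/ζ(s))` on `Re s > 1`**
(as an `LSeriesHasSum` statement for the tree's `limCoeff θ`). -/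
theorem LSeriesHasSum_limCoeff (θ : ℝ) {s : ℂ} (hs : 1 < s.re) :
    LSeriesHasSum (fun n => (limCoeff θ n : ℂ)) s (Complex.exp (2 * θ * L ↗Λ s)) := by
  have hsum := summable_expFamily θ hs
  obtain ⟨A, hA⟩ := hsum
  -- summing by rows identifies `A` with the exponential
  have hrows : HasSum (fun j : ℕ => (((2 * θ) ^ j / (j.factorial : ℝ) : ℝ) : ℂ) * (L ↗Λ s) ^ j) A :=
    hA.prod_fiberwise fun j => hasSum_expFamily_row θ hs j
  have hAexp : A = Complex.exp (2 * θ * L ↗Λ s) := hrows.unique (hasSum_exp_series θ _)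
  -- summing by columns gives the `L`-series of `λ_θ`
  have hswap := (Equiv.prodComm ℕ ℕ).hasSum_iff.2 hA
  have hcols : HasSum (fun n : ℕ => term (fun n => (limCoeff θ n : ℂ)) s n) A :=
    hswap.prod_fiberwise fun n => hasSum_expFamily_col θ s n
  rw [← hAexp]
  exact hcols

/-- RH-FREE.  `exp(−2θ ζ'/ζ(s)) = Σ λ_θ(n) n^{-s}` on `Re s > 1`, value form. [Su20] (1.10). -/
theorem LSeries_limCoeff_eq (θ : ℝ) {s : ℂ} (hs : 1 < s.re) :
    L (fun n => (limCoeff θ n : ℂ)) s = Complex.exp (2 * θ * L ↗Λ s) :=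
  (LSeriesHasSum_limCoeff θ hs).LSeries_eq

/-- RH-FREE.  The same with `ζ'/ζ` spelled out: `Σ λ_θ(n) n^{-s} = exp(−2θ ζ'(s)/ζ(s))` on `Re s > 1`. -/
theorem LSeries_limCoeff_eq_exp_logDeriv_zeta (θ : ℝ) {s : ℂ} (hs : 1 < s.re) :
    L (fun n => (limCoeff θ n : ℂ)) s = Complex.exp (-2 * θ * (deriv riemannZeta s / riemannZeta s)) := by
  rw [LSeries_limCoeff_eq θ hs, ArithmeticFunction.LSeries_vonMangoldt_eq_deriv_riemannZeta_div hs]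
  congr 1
  ring

/-- RH-FREE.  `Σ λ_θ(n) n^{-s}` is summable on `Re s > 1`. -/
theorem LSeriesSummable_limCoeff (θ : ℝ) {s : ℂ} (hs : 1 < s.re) :
    LSeriesSummable (fun n => (limCoeff θ n : ℂ)) s :=
  (LSeriesHasSum_limCoeff θ hs).LSeriesSummable

/-- RH-FREE.  **Absolute convergence**: `Σ |λ_θ(n)| n^{-Re s} < ∞` on `Re s > 1` (each `|λ_θ(n) n^{-s}|` is at most the
column sum `Σ_j ‖a(j,n)‖` of the absolutely summable double family). -/
theorem summable_norm_term_limCoeff (θ : ℝ) {s : ℂ} (hs : 1 < s.re) :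
    Summable fun n : ℕ => ‖term (fun n => (limCoeff θ n : ℂ)) s n‖ := by
  have hN := summable_norm_expFamily θ hs
  have hcolsum : Summable fun n : ℕ =>
      ∑' j : ℕ, ‖(((2 * θ) ^ j / (j.factorial : ℝ) : ℝ) : ℂ) * term ↗(Λ ^ j) s n‖ := hN.prod_symm.prod
  refine Summable.of_nonneg_of_le (fun _ => norm_nonneg _) (fun n => ?_) hcolsum
  rw [← (hasSum_expFamily_col θ s n).tsum_eq]
  exact norm_tsum_le_tsum_norm (hN.prod_symm.prod_factor n)

end Summit.RiemannHypothesis.RiemannHypothesis.Theorems.SuzukiWindowsDoorDirichletSymbol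

end
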